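import Mathlib
import Literature.AlgebraicGeometry.Morphisms.NagataCompactification
import Literature.AlgebraicGeometry.Limits.PushoutOpenImmersion
import Literature.AlgebraicGeometry.Resolution.ProperModelsPatching
import Literature.AlgebraicGeometry.Resolution.RegularLocalRingsProofs

/-!
# drefute gen 3 (refuter-drefute-stmt-ResolutionOfSingularities-0642-g3-0) — hypothesis mutations of the two UNPROVED stubs of line `sandwiched-gluing`
# (crux stmt-ResolutionOfSingularities-0642 `Valuative.PatchingRel`): S6 `NagataCompactification`, S7 SAND⁺

§A  S6 `stub_nagataCompactification : NagataCompactification.{0}` — each morphism hypothesis dropped: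
* (A1) `not_nagataNoFT`  — WITHOUT `LocallyOfFiniteType f` the fact is FALSE: `Spec 𝔽₂(t) → Spec 𝔽₂`
  (an open subscheme of a proper `k`-scheme is of finite type; `k(t)` is not a finitely generated
  `k`-algebra by Zariski's lemma; any ground field works).
* (A2) `not_nagataNoSep` — WITHOUT `IsSeparated f` the fact is FALSE: the affine line with doubled
  origin `𝔸¹ ⨿_{𝔸¹∖0} 𝔸¹ → Spec 𝔽₂` (an open subscheme of a proper, hence separated, scheme is
  separated; the two charts agree on the dense open `𝔸¹ ∖ 0` but differ at the origins).
So both are load-bearing (any proof of S6 must use them); `QuasiCompact f` (witness `∐_ℕ Spec k`)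
and the qcqs base are load-bearing on paper (not formalised here).

§B  S7 `stub_sandwichedStrongResolution : ∀ p, p.Prime → SandwichedStrongResolution.{0} p` — typing slack:
* (B1) `sandNoIntU_iff` — the hypothesis `IsIntegral U` is REDUNDANT (it follows from
  `Scheme.IsRegular U`, `IsIntegral V` and `IsBirational η`);
* (B2) `sandRedV_iff`  — `IsIntegral V` may be weakened to `IsReduced V` (irreducibility of `V`
  follows from that of `U` by birationality).
(The structural hypotheses — regular roof, birational `η`, iso over `Reg` — are load-bearing:
Disproof.lean §6 (T1)–(T3), gen-0 `Mutations.lean`.)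
Tree landings (proposed, `--supports stmt-ResolutionOfSingularities-0642`): `Theorems/PatchingRel/Negative/NagataLoadBearing.lean`
(p75739: A1, A2, `not_isSeparated_pushoutDesc_self`) and `Theorems/PatchingRel/Negative/SandIntegralitySlack.lean` (p76445: B1, B2
as implications + the two integrality helpers).
-/

open CategoryTheory CategoryTheory.Limits AlgebraicGeometry
open Literature.AlgebraicGeometry.Morphisms Literature.AlgebraicGeometry.Limits
open Literature.AlgebraicGeometry.Resolution

namespace DrefuteG3

universe u

/-! ## §A Nagata compactification: the morphism hypotheses are load-bearing -/

/-- S6 with `LocallyOfFiniteType f` dropped. -/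
def NagataNoFT : Prop :=
  ∀ (X S : Scheme.{u}) (f : X ⟶ S) [CompactSpace S] [QuasiSeparatedSpace S]
    [IsSeparated f] [QuasiCompact f],
    ∃ (Xc : Scheme.{u}) (j : X ⟶ Xc) (g : Xc ⟶ S), IsOpenImmersion j ∧ IsProper g ∧ j ≫ g = f

/-- (A1) Nagata without finite type is false: `Spec 𝔽₂(t) → Spec 𝔽₂` has no compactification
(any ground field works). -/
theorem not_nagataNoFT : ¬ NagataNoFT.{0} := by
  intro h
  -- ground field `𝔽₂` (any field works; a prime field avoids the `ℚ`-algebra instance diamond)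
  let k : Type := ZMod 2
  let K : Type := FractionRing (Polynomial k)
  let φ : CommRingCat.of k ⟶ CommRingCat.of K := CommRingCat.ofHom (algebraMap k K)
  obtain ⟨Xc, j, g, hj, hg, hfac⟩ := h (Spec (.of K)) (Spec (.of k)) (Spec.map φ)
  have h1 : LocallyOfFiniteType (Spec.map φ) := by rw [← hfac]; infer_instance
  have h2 := (HasRingHomProperty.Spec_iff (P := @LocallyOfFiniteType)).mp h1
  haveI : Algebra.FiniteType k K := RingHom.finiteType_algebraMap.mp h2
  haveI : Module.Finite k K := finite_of_finite_type_of_isJacobsonRing k K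
  have hT : Transcendental k (algebraMap (Polynomial k) K Polynomial.X) :=
    (transcendental_algebraMap_iff (IsFractionRing.injective (Polynomial k) K)).mpr
      (Polynomial.transcendental_X k)
  exact hT (Algebra.IsAlgebraic.isAlgebraic _)

/-- S6 with `IsSeparated f` dropped. -/
def NagataNoSep : Prop :=
  ∀ (X S : Scheme.{u}) (f : X ⟶ S) [CompactSpace S] [QuasiSeparatedSpace S]
    [LocallyOfFiniteType f] [QuasiCompact f],
    ∃ (Xc : Scheme.{u}) (j : X ⟶ Xc) (g : Xc ⟶ S), IsOpenImmersion j ∧ IsProper g ∧ j ≫ g = f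

/-- **Doubling a scheme along a dense proper open is not separated**: for `Z` integral, `U ⊊ Z` a
non-empty open and any `q : Z → S`, the structure map `Z ⨿_U Z → S` of the pushout of `U ↪ Z`
with itself is not separated (the two charts agree on the dense `U`, so separatedness would force
them to coincide, but a point outside `U` has two distinct images). [folklore] -/
theorem not_isSeparated_pushoutDesc_self {Z S : Scheme.{u}} [IsIntegral Z] (U : Z.Opens)
    (hU : (U : Set Z).Nonempty) (hU' : (U : Set Z) ≠ Set.univ) (q : Z ⟶ S) :
    ¬ IsSeparated (pushout.desc (f := U.ι) (g := U.ι) q q rfl) := by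
  intro hsep
  haveI : IsDominant U.ι := ⟨by
    rw [DenseRange, Scheme.Opens.range_ι]
    exact U.2.dense hU⟩
  have heq : pushout.inl U.ι U.ι = pushout.inr U.ι U.ι :=
    ext_of_isDominant_of_isSeparated (pushout.desc q q rfl)
      (by rw [pushout.inl_desc, pushout.inr_desc]) U.ι pushout.condition
  obtain ⟨z, hz⟩ : ∃ z : Z, z ∉ (U : Set Z) :=
    not_forall.mp fun hcon => hU' (Set.eq_univ_of_forall hcon)
  obtain ⟨w, hw, -⟩ := exists_eq_of_inl_eq_inr U.ι U.ι z z (by rw [heq])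
  apply hz
  rw [← hw, Scheme.Opens.ι_apply]
  exact w.2

/-- The affine line over `𝔽₂` minus its origin, `D(t) ⊆ 𝔸¹ = Spec 𝔽₂[t]`, as an open of the scheme. -/
noncomputable def lineMinusOrigin : (Spec (CommRingCat.of (Polynomial (ZMod 2)))).Opens :=
  PrimeSpectrum.basicOpen (R := Polynomial (ZMod 2)) Polynomial.X

theorem mem_lineMinusOrigin_iff (x : Spec (CommRingCat.of (Polynomial (ZMod 2)))) :
    x ∈ lineMinusOrigin ↔ (Polynomial.X : Polynomial (ZMod 2)) ∉ x.asIdeal :=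
  PrimeSpectrum.mem_basicOpen (R := Polynomial (ZMod 2)) Polynomial.X x

theorem lineMinusOrigin_nonempty :
    ((lineMinusOrigin : (Spec (CommRingCat.of (Polynomial (ZMod 2)))).Opens) :
      Set (Spec (CommRingCat.of (Polynomial (ZMod 2))))).Nonempty := by
  let x : Spec (CommRingCat.of (Polynomial (ZMod 2))) :=
    (⟨⊥, Ideal.isPrime_bot⟩ : PrimeSpectrum (Polynomial (ZMod 2)))
  refine ⟨x, (mem_lineMinusOrigin_iff x).mpr ?_⟩
  change (Polynomial.X : Polynomial (ZMod 2)) ∉ (⊥ : Ideal (Polynomial (ZMod 2)))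
  rw [Ideal.mem_bot]
  exact Polynomial.X_ne_zero

theorem lineMinusOrigin_ne_univ :
    ((lineMinusOrigin : (Spec (CommRingCat.of (Polynomial (ZMod 2)))).Opens) :
      Set (Spec (CommRingCat.of (Polynomial (ZMod 2))))) ≠ Set.univ := by
  intro h
  have hp : (Ideal.span {(Polynomial.X : Polynomial (ZMod 2))}).IsPrime :=
    (Ideal.span_singleton_prime Polynomial.X_ne_zero).mpr Polynomial.prime_X
  let x : Spec (CommRingCat.of (Polynomial (ZMod 2))) :=
    (⟨Ideal.span {(Polynomial.X : Polynomial (ZMod 2))}, hp⟩ : PrimeSpectrum (Polynomial (ZMod 2)))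
  have hmem : x ∈ ((lineMinusOrigin : (Spec (CommRingCat.of (Polynomial (ZMod 2)))).Opens) :
      Set (Spec (CommRingCat.of (Polynomial (ZMod 2))))) := by
    rw [h]; trivial
  have hX : (Polynomial.X : Polynomial (ZMod 2)) ∉ x.asIdeal := (mem_lineMinusOrigin_iff x).mp hmem
  exact hX (Ideal.mem_span_singleton_self _)

/-- (A2) Nagata without separatedness is false: the affine line with doubled origin over `𝔽₂`
(quasi-compact, of finite type, NOT separated) has no open immersion into a proper `𝔽₂`-scheme. -/
theorem not_nagataNoSep : ¬ NagataNoSep.{0} := by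
  intro h
  let k : Type := ZMod 2
  let A : Scheme.{0} := Spec (CommRingCat.of (Polynomial k))
  let U : A.Opens := lineMinusOrigin
  let q : A ⟶ Spec (CommRingCat.of k) := Spec.map (CommRingCat.ofHom (algebraMap k (Polynomial k)))
  let f : pushout U.ι U.ι ⟶ Spec (CommRingCat.of k) := pushout.desc q q rfl
  haveI : LocallyOfFiniteType q := by
    rw [HasRingHomProperty.Spec_iff (P := @LocallyOfFiniteType)]
    exact RingHom.finiteType_algebraMap.mpr inferInstance
  haveI : LocallyOfFiniteType f := locallyOfFiniteType_pushoutDesc U.ι U.ι q q rfl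
  haveI : QuasiCompact f := quasiCompact_pushoutDesc U.ι U.ι q q rfl
  obtain ⟨Xc, j, g, hj, hg, hfac⟩ := h (pushout U.ι U.ι) (Spec (.of k)) f
  have hsep : IsSeparated f := by rw [← hfac]; infer_instance
  exact not_isSeparated_pushoutDesc_self U lineMinusOrigin_nonempty lineMinusOrigin_ne_univ q hsep

/-! ### helpers (copies of `SandwichedGluing.*` from `ProperModelsPatchingGluing.lean`, inlined so this
file does not depend on that module's build) -/

theorem isPreirreducible_range' {X Y : Scheme.{u}} (f : X ⟶ Y) [PreirreducibleSpace X] :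
    IsPreirreducible (Set.range f.base) := by
  rw [← Set.image_univ]
  exact (PreirreducibleSpace.isPreirreducible_univ (X := X)).image _ f.continuous.continuousOn

theorem preirreducibleSpace_of_iso' {X Y : Scheme.{u}} (e : X ≅ Y) [PreirreducibleSpace Y] :
    PreirreducibleSpace X := by
  constructor
  have h := isPreirreducible_range' e.inv
  have hr : Set.range e.inv.base = Set.univ :=
    Set.range_eq_univ.mpr (Scheme.homeoOfIso e.symm).surjective
  rwa [hr] at h

theorem preirreducibleSpace_opens' {X : Scheme.{u}} [PreirreducibleSpace X] (U : X.Opens) :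
    PreirreducibleSpace (U : Scheme.{u}) := by
  constructor
  have h1 : IsPreirreducible (U : Set X) :=
    (PreirreducibleSpace.isPreirreducible_univ (X := X)).open_subset U.2 (Set.subset_univ _)
  have h2 := h1.preimage U.ι.isOpenEmbedding
  have h3 : U.ι.base ⁻¹' (U : Set X) = Set.univ := Set.eq_univ_of_forall fun x => x.2
  rwa [h3] at h2

theorem preirreducibleSpace_of_isBirational' {Z V : Scheme.{u}} (π : Z ⟶ V) (h : IsBirational π)
    [PreirreducibleSpace V] : PreirreducibleSpace Z := by
  obtain ⟨U₀, -, hZU₀, hiso⟩ := h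
  haveI := hiso
  haveI : PreirreducibleSpace (U₀ : Scheme.{u}) := preirreducibleSpace_opens' U₀
  haveI : PreirreducibleSpace (π ⁻¹ᵁ U₀ : Scheme.{u}) := preirreducibleSpace_of_iso' (asIso (π ∣_ U₀))
  have h1 : IsPreirreducible ((π ⁻¹ᵁ U₀ : Z.Opens) : Set Z) := by
    rw [← Scheme.Opens.range_ι]
    exact isPreirreducible_range' _
  have h2 := h1.closure
  rw [hZU₀.closure_eq] at h2
  exact ⟨h2⟩

/-! ## §B SAND⁺: typing slack in the integrality hypotheses -/

/-- From a regular base, an integral source and birationality: the base is integral. [folklore] -/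
theorem isIntegral_base_of_isBirational {U V : Scheme.{u}} (η : V ⟶ U)
    (hreg : Scheme.IsRegular U) [IsIntegral V] (hbir : IsBirational η) : IsIntegral U := by
  haveI : Nonempty U := ⟨η.base (Classical.arbitrary V)⟩
  -- reduced: regular local rings are domains
  haveI : ∀ x : U, _root_.IsReduced (U.presheaf.stalk x) := fun x => by
    haveI := hreg x
    haveI := isDomain_of_isRegularLocalRing (U.presheaf.stalk x)
    infer_instance
  haveI : IsReduced U := isReduced_of_isReduced_stalk U
  -- irreducible: the dense open `U₀` is homeomorphic to the irreducible `η⁻¹ U₀`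
  obtain ⟨U₀, hU₀, hVU₀, hiso⟩ := hbir
  haveI := hiso
  haveI : PreirreducibleSpace (η ⁻¹ᵁ U₀ : Scheme.{u}) := preirreducibleSpace_opens' _
  haveI : PreirreducibleSpace (U₀ : Scheme.{u}) :=
    preirreducibleSpace_of_iso' (asIso (η ∣_ U₀)).symm
  have h1 : IsPreirreducible ((U₀ : U.Opens) : Set U) := by
    rw [← Scheme.Opens.range_ι]
    exact isPreirreducible_range' _
  have h2 := h1.closure
  rw [hU₀.closure_eq] at h2
  haveI : PreirreducibleSpace U := ⟨h2⟩
  haveI : IrreducibleSpace U := ⟨inferInstance⟩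
  exact isIntegral_of_irreducibleSpace_of_isReduced U

/-- S7 with `IsIntegral U` DROPPED. -/
def SandNoIntU (p : ℕ) : Prop :=
  ∀ (k : Type u) [Field k] [CharP k p] (U V : Scheme.{u}) (f : U ⟶ Spec (.of k)) (η : V ⟶ U),
    IsSeparated f → LocallyOfFiniteType f → QuasiCompact f →
    Scheme.IsRegular U → IsIntegral V → IsProper η → IsBirational η →
      ∃ (Y : Scheme.{u}) (π : Y ⟶ V), IsResolution π ∧
        ∃ W : V.Opens, (W : Set V) = Scheme.regularLocus V ∧ IsIso (π ∣_ W)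

/-- (B1) `IsIntegral U` is redundant in SAND⁺. -/
theorem sandNoIntU_iff (p : ℕ) : SandNoIntU.{u} p ↔ SandwichedStrongResolution.{u} p := by
  constructor
  · intro h k _ _ U V f η hsep hft hqc _ hreg hV hη hbir
    exact h k U V f η hsep hft hqc hreg hV hη hbir
  · intro h k _ _ U V f η hsep hft hqc hreg hV hη hbir
    haveI := hV
    exact h k U V f η hsep hft hqc (isIntegral_base_of_isBirational η hreg hbir) hreg hV hη hbir

/-- From an integral base, a reduced source and birationality: the source is integral. [folklore] -/
theorem isIntegral_source_of_isBirational {U V : Scheme.{u}} (η : V ⟶ U) [IsIntegral U]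
    [IsReduced V] (hbir : IsBirational η) : IsIntegral V := by
  haveI : PreirreducibleSpace V := preirreducibleSpace_of_isBirational' η hbir
  obtain ⟨U₀, hU₀, hVU₀, hiso⟩ := hbir
  haveI := hiso
  have hne : ((U₀ : U.Opens) : Set U).Nonempty := hU₀.nonempty
  haveI : Nonempty (U₀ : Scheme.{u}) := ⟨⟨hne.some, hne.some_mem⟩⟩
  haveI : Nonempty (η ⁻¹ᵁ U₀ : Scheme.{u}) := ⟨(inv (η ∣_ U₀)).base (Classical.arbitrary _)⟩
  haveI : Nonempty V := ⟨(η ⁻¹ᵁ U₀).ι.base (Classical.arbitrary _)⟩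
  haveI : IrreducibleSpace V := ⟨inferInstance⟩
  exact isIntegral_of_irreducibleSpace_of_isReduced V

/-- S7 with `IsIntegral V` WEAKENED to `IsReduced V`. -/
def SandRedV (p : ℕ) : Prop :=
  ∀ (k : Type u) [Field k] [CharP k p] (U V : Scheme.{u}) (f : U ⟶ Spec (.of k)) (η : V ⟶ U),
    IsSeparated f → LocallyOfFiniteType f → QuasiCompact f → IsIntegral U →
    Scheme.IsRegular U → IsReduced V → IsProper η → IsBirational η →
      ∃ (Y : Scheme.{u}) (π : Y ⟶ V), IsResolution π ∧
        ∃ W : V.Opens, (W : Set V) = Scheme.regularLocus V ∧ IsIso (π ∣_ W)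

/-- (B2) `IsIntegral V` may be weakened to `IsReduced V` in SAND⁺ (the two forms are equivalent). -/
theorem sandRedV_iff (p : ℕ) : SandRedV.{u} p ↔ SandwichedStrongResolution.{u} p := by
  constructor
  · intro h k _ _ U V f η hsep hft hqc hU hreg hV hη hbir
    haveI := hV
    exact h k U V f η hsep hft hqc hU hreg inferInstance hη hbir
  · intro h k _ _ U V f η hsep hft hqc hU hreg hV hη hbir
    haveI := hU
    haveI := hV
    exact h k U V f η hsep hft hqc hU hreg (isIntegral_source_of_isBirational η hbir) hη hbir

end DrefuteG3
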